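import Mathlib
import Summits.NavierStokesRegularity.NavierStokesRegularity.Theorems.EulerZoomLiouvillePowerGaugeEulerLiouvilleSelfSimilarTopBadNodeThreshold
import HarnessLib.Audit

/-!
# Rung C1 of the crux `EulerZoomLiouville.PowerGaugeEulerLiouville`: the THRESHOLD DICHOTOMY, part 2
# (inventory item (vi-a) of the no-exit lemma — "GAP A" of the addendum, concluded)

Route №10 `EulerZoomLiouville` (NavierStokesRegularity), crux E = stmt-NavierStokesRegularity-19832,
tenure rung C1 (exactly self-similar members), registered residue `stub_selfSimilarExtremal`.
Twenty-first file of the NODAL-CONTINUUM line (lineage ns-typeII-p1, gen 7).  Sequel of `…TopBadNodeThreshold`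
(`cone_persists_of_ineq`), same real-variable setting (`p, m ≥ 0`, `p' ≤ −μp + c(p+m) + Ψ`, `m' ≥ μm − c(p+m) − Ψ` on `[0, t₁]`,
`c(1+K) ≤ μ/4`, `K ≥ 1`, `Ψ ≥ 0`, `Θ ≥ 8(1+K)Ψ/μ`, `Θ > 0`):

* `cone_of_threshold` — if `p(0) + m(0) ≤ Θ` and `p + m ≥ 2(1+K)Θ` at some `t ≤ t₁`, then `Kp ≤ m` and `m ≥ 2Θ` on `[t, t₁]`.
  Proof: `t'` := last time `≤ t` with `p + m ≤ Θ`; on `[t', t]` the gap `m − Kp` is nondecreasing (its derivative is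
  `≥ (3μ/4)(p+m) − (1+K)Ψ > 0` above the threshold); if the cone `{m ≥ Kp}` were avoided on all of `[t', t]`, the decay
  barrier `decay_to_floor_of_ineq` would give `p(t) ≤ Θ + 2Ψ/μ`, whence `p + m < (1+K)p ≤ 2(1+K)Θ` at `t` — so the cone is met
  in `[t', t]`, hence holds at `t` with `m(t) ≥ 2KΘ ≥ 2Θ`, and `cone_persists_of_ineq` carries it to `t₁`.
* `sum_lt_of_not_cone` — the contrapositive used in CASE II-nocone: `m(t₁) < Kp(t₁)` ⇒ `p + m < 2(1+K)Θ` on `[0, t₁]`.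

WHAT THIS IS NOT: not NS, not E — elementary real analysis. [cite: KatokHasselblatt1995, §6.2 (cone criterion)]
-/

noncomputable section

-- flat `Theorems/<Route><Decl>…` files of one crux share the namespace of the crux (tree convention)
set_option linter.dupNamespace false

open Set Filter Topology Metric Function

namespace Summit.NavierStokesRegularity.NavierStokesRegularity.Theorems.PowerGaugeEulerLiouville.NodalContinuum

/-- **Cone from threshold.**  If `p(0)+m(0) ≤ Θ` and `p + m ≥ 2(1+K)Θ` at `t ∈ [0, t₁]`, then `Kp ≤ m` and `2Θ ≤ m` on
`[t, t₁]`. [cite: KatokHasselblatt1995, §6.2 (cone criterion, with forcing)] -/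
theorem cone_of_threshold {p m pd md : ℝ → ℝ} {K μ c Ψ Θ t t₁ : ℝ} (hK1 : 1 ≤ K) (hμ : 0 < μ) (hc0 : 0 ≤ c)
    (hcK : c * (1 + K) ≤ μ / 4) (hΨ : 0 ≤ Ψ) (hΘ : 8 * (1 + K) * Ψ / μ ≤ Θ) (hΘpos : 0 < Θ)
    (hp' : ∀ s ∈ Icc 0 t₁, HasDerivAt p (pd s) s) (hm' : ∀ s ∈ Icc 0 t₁, HasDerivAt m (md s) s)
    (hpnn : ∀ s ∈ Icc 0 t₁, 0 ≤ p s) (hmnn : ∀ s ∈ Icc 0 t₁, 0 ≤ m s)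
    (hpd : ∀ s ∈ Icc 0 t₁, pd s ≤ -μ * p s + c * (p s + m s) + Ψ)
    (hmd : ∀ s ∈ Icc 0 t₁, μ * m s - c * (p s + m s) - Ψ ≤ md s)
    (h0 : p 0 + m 0 ≤ Θ) (ht : t ∈ Icc 0 t₁) (hbig : 2 * (1 + K) * Θ ≤ p t + m t) :
    ∀ u ∈ Icc t t₁, K * p u ≤ m u ∧ 2 * Θ ≤ m u := by
  have hKpos : 0 < K := by linarith
  have hΨΘ : (1 + K) * Ψ ≤ μ * Θ / 8 := by
    have := (div_le_iff₀ hμ).1 hΘ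
    linarith
  have hΨΘ' : Ψ ≤ μ * Θ / 8 := by nlinarith [hΨΘ, hK1, hΨ]
  have hsub0 : Icc 0 t ⊆ Icc 0 t₁ := Icc_subset_Icc le_rfl ht.2
  -- the last time `≤ t` below the threshold
  set S : Set ℝ := {s | s ∈ Icc 0 t ∧ p s + m s ≤ Θ} with hS
  have h0S : (0 : ℝ) ∈ S := ⟨⟨le_rfl, ht.1⟩, h0⟩
  have hSne : S.Nonempty := ⟨0, h0S⟩
  have hSbdd : BddAbove S := ⟨t, fun s hs => hs.1.2⟩
  have hcont : ContinuousOn (fun s => p s + m s) (Icc 0 t) := fun s hs =>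
    ((hp' s (hsub0 hs)).add (hm' s (hsub0 hs))).continuousAt.continuousWithinAt
  have hSclosed : IsClosed S := by
    have : S = Icc 0 t ∩ (fun s => p s + m s) ⁻¹' Iic Θ := by
      ext s; simp only [hS, mem_setOf_eq, mem_inter_iff, mem_preimage, mem_Iic]
    rw [this]
    exact hcont.preimage_isClosed_of_isClosed isClosed_Icc isClosed_Iic
  set t' := sSup S with ht'
  have ht'S : t' ∈ S := hSclosed.csSup_mem hSne hSbdd
  have ht'0 : 0 ≤ t' := ht'S.1.1
  have ht't : t' ≤ t := ht'S.1.2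
  have hΘt' : p t' + m t' ≤ Θ := ht'S.2
  have ht'lt : t' < t := by
    rcases ht't.eq_or_lt with h1 | h1
    · rw [h1] at hΘt'; nlinarith [hΘt', hbig, hΘpos, hK1]
    · exact h1
  have hafter : ∀ s ∈ Ioc t' t, Θ < p s + m s := by
    intro s hs
    by_contra hle
    push Not at hle
    have hsS : s ∈ S := ⟨⟨ht'0.trans hs.1.le, hs.2⟩, hle⟩
    exact absurd (le_csSup hSbdd hsS) (not_le.2 hs.1)
  have hsub' : Icc t' t ⊆ Icc 0 t₁ := fun s hs => ⟨ht'0.trans hs.1, hs.2.trans ht.2⟩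
  -- `D = m − Kp` is nondecreasing on `[t', t]`
  have hDmono : MonotoneOn (fun s => m s - K * p s) (Icc t' t) := by
    have hder : ∀ s ∈ Icc t' t, HasDerivAt (fun s => m s - K * p s) (md s - K * pd s) s :=
      fun s hs => (hm' s (hsub' hs)).sub ((hp' s (hsub' hs)).const_mul K)
    refine monotoneOn_of_deriv_nonneg (convex_Icc _ _)
      (fun s hs => (hder s hs).continuousAt.continuousWithinAt)
      (fun s hs => (hder s (interior_subset hs)).differentiableAt.differentiableWithinAt) ?_
    intro s hs
    rw [interior_Icc] at hs
    rw [(hder s (Ioo_subset_Icc_self hs)).deriv]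
    have hs' : s ∈ Icc 0 t₁ := hsub' (Ioo_subset_Icc_self hs)
    have h1 := hpd s hs'
    have h2 := hmd s hs'
    have hps := hpnn s hs'
    have hms := hmnn s hs'
    have hbigs := hafter s ⟨hs.1, hs.2.le⟩
    have h1K := mul_le_mul_of_nonneg_left h1 hKpos.le
    have h3 : c * (1 + K) * (p s + m s) ≤ μ / 4 * (p s + m s) :=
      mul_le_mul_of_nonneg_right hcK (by linarith)
    have e1 : c * (1 + K) * (p s + m s) = c * (p s + m s) + K * (c * (p s + m s)) := by ring
    have h4 : μ * p s ≤ μ * (K * p s) :=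
      mul_le_mul_of_nonneg_left (le_mul_of_one_le_left hps hK1) hμ.le
    have h5 : μ * Θ ≤ μ * (p s + m s) := mul_le_mul_of_nonneg_left hbigs.le hμ.le
    have h6 : 0 ≤ μ * Θ := by positivity
    linarith [h1K, h2, h3, e1, h4, h5, h6, hΨΘ]
  -- the cone is met in `[t', t]`
  have hmeet : ∃ s₀ ∈ Icc t' t, K * p s₀ ≤ m s₀ := by
    by_contra hno
    push Not at hno
    -- decay barrier for the shifted function on `[0, t − t']`
    set ps : ℝ → ℝ := fun s => p (t' + s) with hps
    set ms : ℝ → ℝ := fun s => m (t' + s) with hms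
    set pds : ℝ → ℝ := fun s => pd (t' + s) with hpds
    have hshift : ∀ s ∈ Icc 0 (t - t'), t' + s ∈ Icc t' t := fun s hs =>
      ⟨by linarith [hs.1], by linarith [hs.2]⟩
    have hps' : ∀ s ∈ Icc 0 (t - t'), HasDerivAt ps (pds s) s := fun s hs =>
      (hp' (t' + s) (hsub' (hshift s hs))).comp_const_add t' s
    have hpsnn : ∀ s ∈ Icc 0 (t - t'), 0 ≤ ps s := fun s hs => hpnn _ (hsub' (hshift s hs))
    have hpsd : ∀ s ∈ Icc 0 (t - t'), pds s ≤ -μ * ps s + c * (ps s + ms s) + Ψ := fun s hs =>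
      hpd _ (hsub' (hshift s hs))
    have hcone' : ∀ s ∈ Icc 0 (t - t'), ms s < K * ps s + 0 := fun s hs => by
      simpa only [add_zero] using hno _ (hshift s hs)
    have hdec := decay_to_floor_of_ineq (K := K) hμ hc0 (hcK.trans (by linarith)) hΨ le_rfl hps' hpsnn hpsd
      hcone' (t := t - t') ⟨by linarith, le_rfl⟩
    simp only [hps, add_zero, mul_zero, zero_add, add_sub_cancel] at hdec
    have hexp : Real.exp (-(μ / 2) * (t - t')) ≤ 1 := by
      rw [Real.exp_le_one_iff]; nlinarith [hμ, ht'lt]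
    have hpt' : p t' ≤ Θ := by linarith [hΘt', hmnn t' (hsub' ⟨le_rfl, ht'lt.le⟩)]
    have hpt'0 : 0 ≤ p t' := hpnn t' (hsub' ⟨le_rfl, ht'lt.le⟩)
    have h1 : p t' * Real.exp (-(μ / 2) * (t - t')) ≤ Θ := by nlinarith [hexp, hpt', hpt'0, Real.exp_pos (-(μ / 2) * (t - t'))]
    have hpt : p t ≤ Θ + 2 * Ψ / μ := by linarith [hdec, h1]
    have h2Ψ : 2 * Ψ / μ ≤ Θ := by
      rw [div_le_iff₀ hμ]; nlinarith [hΨΘ', hμ, hΘpos]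
    have hmt := hno t ⟨ht'lt.le, le_rfl⟩
    have h3 : p t + m t < (1 + K) * p t := by linarith [hmt]
    have h4 : (1 + K) * p t ≤ (1 + K) * (2 * Θ) := mul_le_mul_of_nonneg_left (by linarith) (by linarith)
    linarith [hbig, h3, h4]
  obtain ⟨s₀, hs₀, hcone₀⟩ := hmeet
  have hDt : K * p t ≤ m t := by
    have := hDmono hs₀ ⟨ht'lt.le, le_rfl⟩ hs₀.2
    simp only at this
    linarith [this, hcone₀]
  have hmt : 2 * Θ ≤ m t := by
    have h1 : (1 + K) * (2 * K * Θ) ≤ (1 + K) * m t := by nlinarith [hbig, hDt, hKpos]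
    have h2 := le_of_mul_le_mul_left h1 (by linarith)
    nlinarith [h2, hK1, hΘpos]
  exact cone_persists_of_ineq hK1 hμ hc0 hcK hΨ hΘ hΘpos hp' hm' hpnn hpd hmd ht hDt hmt

/-- **Contrapositive (CASE II-nocone).**  If `p(0)+m(0) ≤ Θ` and the cone fails at the final time, `m(t₁) < Kp(t₁)`, then
`p + m < 2(1+K)Θ` on all of `[0, t₁]`. [cite: KatokHasselblatt1995, §6.2 (cone criterion, with forcing)] -/
theorem sum_lt_of_not_cone {p m pd md : ℝ → ℝ} {K μ c Ψ Θ t₁ : ℝ} (hK1 : 1 ≤ K) (hμ : 0 < μ) (hc0 : 0 ≤ c)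
    (hcK : c * (1 + K) ≤ μ / 4) (hΨ : 0 ≤ Ψ) (hΘ : 8 * (1 + K) * Ψ / μ ≤ Θ) (hΘpos : 0 < Θ)
    (hp' : ∀ s ∈ Icc 0 t₁, HasDerivAt p (pd s) s) (hm' : ∀ s ∈ Icc 0 t₁, HasDerivAt m (md s) s)
    (hpnn : ∀ s ∈ Icc 0 t₁, 0 ≤ p s) (hmnn : ∀ s ∈ Icc 0 t₁, 0 ≤ m s)
    (hpd : ∀ s ∈ Icc 0 t₁, pd s ≤ -μ * p s + c * (p s + m s) + Ψ)
    (hmd : ∀ s ∈ Icc 0 t₁, μ * m s - c * (p s + m s) - Ψ ≤ md s)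
    (h0 : p 0 + m 0 ≤ Θ) (hnc : m t₁ < K * p t₁) :
    ∀ t ∈ Icc 0 t₁, p t + m t < 2 * (1 + K) * Θ := by
  intro t ht
  by_contra hge
  push Not at hge
  have := (cone_of_threshold hK1 hμ hc0 hcK hΨ hΘ hΘpos hp' hm' hpnn hmnn hpd hmd h0 ht hge) t₁ ⟨ht.2, le_rfl⟩
  linarith [this.1]

end Summit.NavierStokesRegularity.NavierStokesRegularity.Theorems.PowerGaugeEulerLiouville.NodalContinuum
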